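import Summits.SmoothPoincare4.SmoothPoincare4.Theorems.DottedCircleRasmussenDcrGapHelperFriendsCarrierVkPartAOfInput

/-!
# Helper `helper_friendsCarrier_Vk_partA_partIII_frameAt` (piece of the registered stub
`helper_friendsCarrier_Vk_partA_partIII`, line `mk_friends`, skeleton v9) for crux `DcrGap`
(item stmt-SmoothPoincare4-16128, route route-SmoothPoincare4-DottedCircleRasmussen)

**A global transversal frame of an immersed disc through a prescribed transversal pair at one point.**
For a `C^∞` map `f : ℝ² → ℝ⁴` immersive on the closed disc `B̄(0, S)` and a pair `(n₀, n₁)` transversal to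
`df(x₀)` at a point `x₀` of that disc, there are `C^∞` fields `m₀, m₁` on `ℝ²`, transversal to `df` on
`B̄(0, S)`, with `mᵢ x₀ = nᵢ`.  Proof: the tree's normal frame by ray transport
(`Literature.Topology.FourManifolds.exists_normalFrame`, Hirsch Ch. 4 §2 Cor. 2.5) cut off to global fields
(`contDiff_bump_smul`), then the constant change of frame
`mᵢ = df(·) vᵢ + aᵢ n₀' + cᵢ n₁'` whose coefficients are those of `nᵢ` in the frame
`(df(x₀) e₀, df(x₀) e₁, n₀' x₀, n₁' x₀)` (`decomp_of_transversal`); the `2 × 2` block `(aᵢ, cᵢ)` is invertible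
because `(n₀, n₁)` is transversal at `x₀`.

* `helper_friendsCarrier_Vk_partA_partIII_frameAt` — the statement.

No definitions, no named facts, no `sorry`.

## References

* M. W. Hirsch, *Differential Topology*, GTM 33 (1976), Ch. 4 §2 Cor. 2.5. [Hirsch1976]
-/

-- the prescribed namespace `Summit.<P>.<Sub>.…` duplicates `SmoothPoincare4` (P = Sub)
set_option linter.dupNamespace false
set_option linter.style.longLine false

noncomputable section

open scoped Manifold ContDiff Topology RealInnerProductSpace
open Set Function Metric Filter
open Literature.Topology.FourManifolds

namespace Summit.SmoothPoincare4.SmoothPoincare4.Theorems.DcrGap.MkFriends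

namespace FriendsCarrierVk

/-- A `2 × 2` system with non-zero determinant has only the trivial solution. [folklore] -/
theorem eq_zero_of_det_ne_zero {a b c d α β : ℝ} (hdet : a * d - b * c ≠ 0) (h1 : α * a + β * b = 0)
    (h2 : α * c + β * d = 0) : α = 0 ∧ β = 0 := by
  have hα : α * (a * d - b * c) = 0 := by linear_combination d * h1 - b * h2
  have hβ : β * (a * d - b * c) = 0 := by linear_combination a * h2 - c * h1
  exact ⟨(mul_eq_zero.1 hα).resolve_right hdet, (mul_eq_zero.1 hβ).resolve_right hdet⟩

/-- **A global transversal frame through a prescribed transversal pair at one point** (see the module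
docstring). [cite: Hirsch1976, Ch. 4 §2 Cor. 2.5] -/
theorem exists_frameAt {f : EuclideanSpace ℝ (Fin 2) → EuclideanSpace ℝ (Fin 4)} (hf : ContDiff ℝ ∞ f) {S : ℝ}
    (hS : 0 < S) (himm : ∀ x ∈ closedBall (0 : EuclideanSpace ℝ (Fin 2)) S, Injective (fderiv ℝ f x))
    {x₀ : EuclideanSpace ℝ (Fin 2)} (hx₀ : x₀ ∈ closedBall (0 : EuclideanSpace ℝ (Fin 2)) S)
    {n₀ n₁ : EuclideanSpace ℝ (Fin 4)}
    (htr₀ : ∀ (e : EuclideanSpace ℝ (Fin 2)) (α β : ℝ), fderiv ℝ f x₀ e + α • n₀ + β • n₁ = 0 → e = 0 ∧ α = 0 ∧ β = 0) :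
    ∃ m₀ m₁ : EuclideanSpace ℝ (Fin 2) → EuclideanSpace ℝ (Fin 4), ContDiff ℝ ∞ m₀ ∧ ContDiff ℝ ∞ m₁ ∧
      m₀ x₀ = n₀ ∧ m₁ x₀ = n₁ ∧
      ∀ x ∈ closedBall (0 : EuclideanSpace ℝ (Fin 2)) S, ∀ (e : EuclideanSpace ℝ (Fin 2)) (α β : ℝ),
        fderiv ℝ f x e + α • m₀ x + β • m₁ x = 0 → e = 0 ∧ α = 0 ∧ β = 0 := by
  ------------------------------------------------------------------
  -- a normal frame near the closed disc, cut off to global fields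
  ------------------------------------------------------------------
  obtain ⟨R', n, hR', himm', hns, hnP, hnli⟩ :=
    exists_normalFrame hf (finrank_euclideanSpace_fin (𝕜 := ℝ) (n := 4)) hS himm
  have htrn : ∀ x ∈ ball (0 : EuclideanSpace ℝ (Fin 2)) R', ∀ (e : EuclideanSpace ℝ (Fin 2)) (α β : ℝ),
      fderiv ℝ f x e + α • n 0 x + β • n 1 x = 0 → e = 0 ∧ α = 0 ∧ β = 0 := by
    intro x hx e α β h
    have htr := (transversal_iff_linearIndependent_normProj (himm' x hx) (fun i => n i x)).2 (by
      have heq : (fun i => normProj (fderiv ℝ f x) (n i x)) = fun i => n i x := funext fun i => hnP x hx i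
      rw [heq]; exact hnli x hx)
    obtain ⟨he, ha⟩ := htr e (!₂[α, β]) (by rw [Fin.sum_univ_two]; simpa [add_assoc] using h)
    exact ⟨he, by simpa using congrArg (fun z : EuclideanSpace ℝ (Fin 2) => z 0) ha,
      by simpa using congrArg (fun z : EuclideanSpace ℝ (Fin 2) => z 1) ha⟩
  have horth : ∀ x ∈ ball (0 : EuclideanSpace ℝ (Fin 2)) R', ∀ i, ∀ e : EuclideanSpace ℝ (Fin 2), ⟪fderiv ℝ f x e, n i x⟫ = 0 :=
    fun x hx i => (normProj_eq_self_iff (himm' x hx) (n i x)).1 (hnP x hx i)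
  set R₁ : ℝ := (2 * S + R') / 3 with hR₁
  set R₂ : ℝ := (S + 2 * R') / 3 with hR₂
  have hSR₁ : S < R₁ := by rw [hR₁]; linarith
  have hR₁₂ : R₁ < R₂ := by rw [hR₁, hR₂]; linarith
  have hR₂' : R₂ < R' := by rw [hR₂]; linarith
  let χ : ContDiffBump (0 : EuclideanSpace ℝ (Fin 2)) := ⟨R₁, R₂, by linarith, hR₁₂⟩
  set m : Fin 2 → EuclideanSpace ℝ (Fin 2) → EuclideanSpace ℝ (Fin 4) := fun i x => χ x • n i x with hm
  have hms : ∀ i, ContDiff ℝ ∞ (m i) := fun i => contDiff_bump_smul χ hR₂' (hns i)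
  have hmn : ∀ i, ∀ x ∈ closedBall (0 : EuclideanSpace ℝ (Fin 2)) R₁, m i x = n i x := fun i x hx => by
    simp only [hm]
    rw [χ.one_of_mem_closedBall (by simpa using hx), one_smul]
  have hsub₁ : closedBall (0 : EuclideanSpace ℝ (Fin 2)) R₁ ⊆ ball 0 R' := closedBall_subset_ball (by linarith)
  have hsubS : closedBall (0 : EuclideanSpace ℝ (Fin 2)) S ⊆ closedBall 0 R₁ := closedBall_subset_closedBall hSR₁.le
  have htrm : ∀ x ∈ closedBall (0 : EuclideanSpace ℝ (Fin 2)) R₁, ∀ (e : EuclideanSpace ℝ (Fin 2)) (α β : ℝ),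
      fderiv ℝ f x e + α • m 0 x + β • m 1 x = 0 → e = 0 ∧ α = 0 ∧ β = 0 := fun x hx e α β h => by
    rw [hmn 0 x hx, hmn 1 x hx] at h
    exact htrn x (hsub₁ hx) e α β h
  ------------------------------------------------------------------
  -- the coefficients of `n₀`, `n₁` in the frame at `x₀`
  ------------------------------------------------------------------
  have hx₀₁ : x₀ ∈ closedBall (0 : EuclideanSpace ℝ (Fin 2)) R₁ := hsubS hx₀
  have hdec : ∀ b : EuclideanSpace ℝ (Fin 4), ∃ (v : EuclideanSpace ℝ (Fin 2)) (a c : ℝ),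
      b = fderiv ℝ f x₀ v + a • m 0 x₀ + c • m 1 x₀ := fun b =>
    ⟨_, _, _, decomp_of_transversal (fderiv ℝ f x₀) (m 0 x₀) (m 1 x₀) b (htrm x₀ hx₀₁)
      (fun e => by rw [hmn 0 x₀ hx₀₁]; exact horth x₀ (hsub₁ hx₀₁) 0 e)
      (fun e => by rw [hmn 1 x₀ hx₀₁]; exact horth x₀ (hsub₁ hx₀₁) 1 e)⟩
  obtain ⟨v₀, a, c, h0⟩ := hdec n₀
  obtain ⟨v₁, b, d, h1⟩ := hdec n₁
  have hdet : a * d - b * c ≠ 0 := by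
    refine det_ne_zero_of_columns fun α β hab hcd => ?_
    have key : fderiv ℝ f x₀ (-(α • v₀ + β • v₁)) + α • n₀ + β • n₁ = 0 := by
      rw [h0, h1, map_neg, map_add, map_smul, map_smul]
      have expand : -(α • fderiv ℝ f x₀ v₀ + β • fderiv ℝ f x₀ v₁) +
          α • (fderiv ℝ f x₀ v₀ + a • m 0 x₀ + c • m 1 x₀) + β • (fderiv ℝ f x₀ v₁ + b • m 0 x₀ + d • m 1 x₀) =
          (α * a + β * b) • m 0 x₀ + (α * c + β * d) • m 1 x₀ := by
        simp only [smul_add, smul_smul, add_smul, neg_add]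
        abel
      rw [expand, hab, hcd, zero_smul, zero_smul, add_zero]
    have := htr₀ _ α β key
    exact ⟨this.2.1, this.2.2⟩
  ------------------------------------------------------------------
  -- the new frame
  ------------------------------------------------------------------
  have hdf : ContDiff ℝ ∞ (fderiv ℝ f) := hf.fderiv_right (m := ∞) (by simp)
  set M₀ : EuclideanSpace ℝ (Fin 2) → EuclideanSpace ℝ (Fin 4) := fun x => fderiv ℝ f x v₀ + a • m 0 x + c • m 1 x with hM₀
  set M₁ : EuclideanSpace ℝ (Fin 2) → EuclideanSpace ℝ (Fin 4) := fun x => fderiv ℝ f x v₁ + b • m 0 x + d • m 1 x with hM₁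
  have hlin : ∀ v : EuclideanSpace ℝ (Fin 2), ContDiff ℝ ∞ fun x => fderiv ℝ f x v := fun v =>
    hdf.clm_apply contDiff_const
  have hsm : ∀ (i : Fin 2) (r : ℝ), ContDiff ℝ ∞ fun x => r • m i x := fun i r => (hms i).const_smul r
  have hM₀s : ContDiff ℝ ∞ M₀ := ((hlin v₀).add (hsm 0 a)).add (hsm 1 c)
  have hM₁s : ContDiff ℝ ∞ M₁ := ((hlin v₁).add (hsm 0 b)).add (hsm 1 d)
  have hM₀x : M₀ x₀ = n₀ := h0.symm
  have hM₁x : M₁ x₀ = n₁ := h1.symm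
  have htrM : ∀ x ∈ closedBall (0 : EuclideanSpace ℝ (Fin 2)) S, ∀ (e : EuclideanSpace ℝ (Fin 2)) (α β : ℝ),
      fderiv ℝ f x e + α • M₀ x + β • M₁ x = 0 → e = 0 ∧ α = 0 ∧ β = 0 := by
    intro x hx e α β h
    have hx₁ : x ∈ closedBall (0 : EuclideanSpace ℝ (Fin 2)) R₁ := hsubS hx
    have expand : fderiv ℝ f x e + α • M₀ x + β • M₁ x =
        fderiv ℝ f x (e + α • v₀ + β • v₁) + (α * a + β * b) • m 0 x + (α * c + β * d) • m 1 x := by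
      simp only [hM₀, hM₁, map_add, map_smul, smul_add, smul_smul, add_smul]
      abel
    rw [expand] at h
    obtain ⟨he, hab, hcd⟩ := htrm x hx₁ _ _ _ h
    obtain ⟨hα, hβ⟩ := eq_zero_of_det_ne_zero hdet hab hcd
    refine ⟨?_, hα, hβ⟩
    rw [hα, hβ, zero_smul, zero_smul, add_zero, add_zero] at he
    exact he
  exact ⟨M₀, M₁, hM₀s, hM₁s, hM₀x, hM₁x, htrM⟩

end FriendsCarrierVk

open FriendsCarrierVk in
/-- **Helper `helper_friendsCarrier_Vk_partA_partIII_frameAt`** (piece of `helper_friendsCarrier_Vk_partA_partIII`: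
a global `C^∞` frame transversal to an immersed disc on `B̄(0, S)` through a prescribed transversal pair at one
point; see the module docstring). [cite: Hirsch1976, Ch. 4 §2 Cor. 2.5] -/
theorem helper_friendsCarrier_Vk_partA_partIII_frameAt : ∀ (f : EuclideanSpace ℝ (Fin 2) → EuclideanSpace ℝ (Fin 4)) (S : ℝ) (x₀ : EuclideanSpace ℝ (Fin 2)) (n₀ n₁ : EuclideanSpace ℝ (Fin 4)), ContDiff ℝ ∞ f → 0 < S → (∀ x ∈ closedBall (0 : EuclideanSpace ℝ (Fin 2)) S, Injective (fderiv ℝ f x)) → x₀ ∈ closedBall (0 : EuclideanSpace ℝ (Fin 2)) S → (∀ (e : EuclideanSpace ℝ (Fin 2)) (α β : ℝ), fderiv ℝ f x₀ e + α • n₀ + β • n₁ = 0 → e = 0 ∧ α = 0 ∧ β = 0) → ∃ m₀ m₁ : EuclideanSpace ℝ (Fin 2) → EuclideanSpace ℝ (Fin 4), ContDiff ℝ ∞ m₀ ∧ ContDiff ℝ ∞ m₁ ∧ m₀ x₀ = n₀ ∧ m₁ x₀ = n₁ ∧ ∀ x ∈ closedBall (0 : EuclideanSpace ℝ (Fin 2))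 S, ∀ (e : EuclideanSpace ℝ (Fin 2)) (α β : ℝ), fderiv ℝ f x e + α • m₀ x + β • m₁ x = 0 → e = 0 ∧ α = 0 ∧ β = 0 :=
  fun _ _ _ _ _ hf hS himm hx₀ htr₀ => exists_frameAt hf hS himm hx₀ htr₀

end Summit.SmoothPoincare4.SmoothPoincare4.Theorems.DcrGap.MkFriends

end
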